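import Literature.Computability.Complexity.ListBricks
import Literature.Computability.Complexity.FoldBricks
import Literature.Computability.Complexity.CyclicListArith
import HarnessLib

/-!
# Cyclic list bricks: multiplication in `ℤ_n[X]/(X^r - 1)` as an `FP` string function

Toolkit (`Computability/Complexity`, the `FP` string algebra of `BrickAlgebra.lean`, `ListBricks.lean`,
`FoldBricks.lean`), realising the list-level model of `CyclicListArith.lean` (`CycList.rot`, `CycList.axpy`,
`CycList.mul`: arithmetic of the AKS congruence test [AKS04, §5] on highest-degree-first coefficient
lists reduced modulo `n`). Every brick is a total string function on records whose FIRST FIELD is the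
context `x = ⟨ν, u⟩` — `ν` the numeral of the modulus `n` (read by `bitsToNat ∘ fstF`), `u` any padding
making `|x|` at least the number of coefficients (the yardstick clocking the list loops):

* `Brick.pcode l = encList (l.map encodeNat)` — the code of a coefficient list, `encList_append`;
* `Brick.rotF` — `CycList.rot` on codes (`tail ++ [head]`, no loop);
* `Brick.axpyG ⟨x, ⟨a, ⟨b, c⟩⟩⟩ = encodeNat ((⟦a⟧ ⟦b⟧ + ⟦c⟧) mod n)` (guarded: `ε` unless `n ≥ 2`), the item
  function of `CycList.axpy` for `Brick.zipLF`, with output length `≤ |x|` on every input;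
* `Brick.mstepG` — one Horner step `acc ↦ axpy n aᵢ B (rot acc)` as the step of `Brick.zipFoldLF`;
* `Brick.zeroOfG ⟨x, A⟩` — the zero list of the length of `A`; **`Brick.mulG ⟨x, ⟨A, B⟩⟩ = pcode (mul n A B)`**
  (`mulG_apply`), `mulG ∈ FP` (`mulG_mem_FP`), and the ABSOLUTE output bound `|mulG z| ≤ G(|fstF z|)`
  (`length_mulG_le`) under which `mulG` may serve as the body of a further counted loop (the powering loop
  of `CyclicPowBricks.lean`).

## References

* [AKS04] M. Agrawal, N. Kayal, N. Saxena, *PRIMES is in P*, Ann. of Math. 160 (2004) 781–793, §5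
  (Thm 5.1: `O~(r log² n)` per multiplication of degree-`< r` polynomials with `O(log n)`-bit coefficients).
* S. Arora, B. Barak, *Computational Complexity: A Modern Approach*, CUP 2009, §1.3 (polynomial time is
  closed under composition and bounded loops).
* D. E. Knuth, *The Art of Computer Programming*, Vol. 2, 3rd ed., 1998, §4.6.1.
-/

namespace Literature.Computability.Complexity

open _root_.Computability Polynomial

namespace Brick

/-! ### Codes of coefficient lists -/

/-- The code of a coefficient list: the coded list of the canonical numerals. [folklore] -/
def pcode (l : List ℕ) : List Bool := encList (l.map encodeNat)

/-- `pcode []`. [folklore] -/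
@[simp] theorem pcode_nil : pcode [] = [] := rfl

/-- `pcode` of a cons. [folklore] -/
@[simp] theorem pcode_cons (a : ℕ) (l : List ℕ) : pcode (a :: l) = boolPair (encodeNat a) (pcode l) := rfl

/-- The list coding is a concatenation of frames: `encList (l₁ ++ l₂) = encList l₁ ++ encList l₂`. [folklore] -/
theorem encList_append : ∀ l₁ l₂ : List (List Bool), encList (l₁ ++ l₂) = encList l₁ ++ encList l₂
  | [], l₂ => rfl
  | a :: l₁, l₂ => by
    rw [List.cons_append, encList_cons, encList_cons, encList_append l₁ l₂]
    simp [boolPair, List.append_assoc]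

/-- Items of a `pcode` are at most as long as the numeral of a bound on the entries. [folklore] -/
theorem length_pcode_le {l : List ℕ} {n : ℕ} (h : ∀ v ∈ l, v < n) :
    (pcode l).length ≤ l.length * (2 * (encodeNat n).length + 2) := by
  induction l with
  | nil => simp
  | cons a l ih =>
    have ha := length_encodeNat_mono (h a (by simp)).le
    have ih' := ih fun v hv => h v (by simp [hv])
    rw [pcode_cons, length_boolPair, List.length_cons]
    have : (l.length + 1) * (2 * (encodeNat n).length + 2) =
        l.length * (2 * (encodeNat n).length + 2) + (2 * (encodeNat n).length + 2) := by ring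
    rw [this]
    omega

/-! ### Rotation -/

/-- **`rotF z = sndF z ++ ⟨fstF z, ε⟩`**: on the code of a nonempty list, move the head item to the back
(`CycList.rot`, multiplication by `X` modulo `X^r - 1` on highest-first coefficient lists).
[cite: AgrawalKayalSaxena2004, §5] -/
noncomputable def rotF : List Bool → List Bool := appF ∘ fanoutFn sndF (fanoutFn fstF (fun _ => []))

/-- `rotF` spelled out. [folklore] -/
theorem rotF_apply (z : List Bool) : rotF z = sndF z ++ boolPair (fstF z) [] := by
  simp [rotF]

/-- `rotF ∈ FP`. [folklore] -/
theorem rotF_mem_FP : rotF ∈ FP :=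
  comp_mem_FP appF_mem_FP (fanoutFn_mem_FP sndF_mem_FP (fanoutFn_mem_FP fstF_mem_FP (const_mem_FP _)))

/-- `rotF` on the code of a nonempty list is the code of the rotated list. [folklore] -/
theorem rotF_pcode {l : List ℕ} (hl : l ≠ []) : rotF (pcode l) = pcode (CycList.rot l) := by
  obtain ⟨a, t, rfl⟩ := List.exists_cons_of_ne_nil hl
  rw [rotF_apply, pcode_cons, fstF_boolPair, sndF_boolPair, CycList.rot]
  show _ = encList ((t ++ [a]).map encodeNat)
  rw [List.map_append, encList_append]
  rfl

/-- `rotF` grows its argument by at most two symbols. [folklore] -/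
theorem length_rotF_le (z : List Bool) : (rotF z).length ≤ z.length + 2 := by
  have h := length_fstF_sndF_le z
  rw [rotF_apply, List.length_append, length_boolPair]
  simp only [List.length_nil]
  omega

/-! ### The coefficient step `(a, b, c) ↦ (a b + c) mod n` -/

/-- **`axpyG ⟨x, ⟨a, ⟨b, c⟩⟩⟩ = encodeNat ((⟦a⟧ ⟦b⟧ + ⟦c⟧) mod n)`** for the modulus `n = ⟦fstF x⟧ ≥ 2`
of the context, and `ε` otherwise (the guard bounds the output by `|x|` on every input).
[cite: KnuthTAOCP2, §4.6.1] -/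
noncomputable def axpyG : List Bool → List Bool :=
  iteFn (valGeTwoFn ∘ fstF ∘ fstF)
    (remFn ∘ fanoutFn (addFn ∘ fanoutFn (prodFn ∘ fanoutFn (nthF 1) (nthF 2)) (sndPow 2)) (fstF ∘ fstF))
    (fun _ => [])

/-- `axpyG ∈ FP`. [folklore] -/
theorem axpyG_mem_FP : axpyG ∈ FP :=
  iteFn_mem_FP (comp_mem_FP valGeTwoFn_mem_FP (comp_mem_FP fstF_mem_FP fstF_mem_FP))
    (comp_mem_FP remFn_mem_FP (fanoutFn_mem_FP
      (comp_mem_FP addFn_mem_FP (fanoutFn_mem_FP (comp_mem_FP prodFn_mem_FP (fanoutFn_mem_FP (nthF_mem_FP 1) (nthF_mem_FP 2))) (sndPow_mem_FP 2)))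
      (comp_mem_FP fstF_mem_FP fstF_mem_FP)))
    (const_mem_FP _)

/-- Value of `axpyG` on a record. [folklore] -/
theorem axpyG_apply (x p b c : List Bool) :
    axpyG (boolPair x (boolPair p (boolPair b c))) =
      if 2 ≤ bitsToNat (fstF x) then encodeNat ((bitsToNat p * bitsToNat b + bitsToNat c) % bitsToNat (fstF x)) else [] := by
  by_cases h : 2 ≤ bitsToNat (fstF x)
  · rw [axpyG, iteFn_apply_true (by simp [valGeTwoFn, h]), if_pos h]
    simp
  · rw [axpyG, iteFn_apply_false (by simp [valGeTwoFn, h]), if_neg h]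

/-- **Growth of `axpyG`**: at most `|x|` symbols, on every input. [folklore] -/
theorem length_axpyG_le (x p b c : List Bool) :
    (axpyG (boolPair x (boolPair p (boolPair b c)))).length ≤ 0 * (b.length + c.length) + (X : Polynomial ℕ).eval x.length := by
  rw [axpyG_apply, zero_mul, zero_add, eval_X]
  split_ifs with h
  · refine (length_encodeNat_mono (Nat.mod_lt _ (by omega)).le).trans ?_
    exact (length_encodeNat_bitsToNat_le _).trans ((length_fstF_sndF_le x).trans' (by omega))
  · simp

/-- `zipImages axpyG` over two coded coefficient lists is the code of `CycList.axpy`. [folklore] -/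
theorem zipImages_axpyG {x : List Bool} (hx : 2 ≤ bitsToNat (fstF x)) (a : ℕ) : ∀ (B C : List ℕ),
    zipImages axpyG x (encodeNat a) (B.map encodeNat) (C.map encodeNat) =
      (CycList.axpy (bitsToNat (fstF x)) a B C).map encodeNat
  | [], C => by simp [zipImages, CycList.axpy]
  | b :: B, [] => by simp [zipImages, CycList.axpy]
  | b :: B, c :: C => by
    have ih := zipImages_axpyG hx a B C
    simp only [zipImages, CycList.axpy, List.map_cons, List.zipWith_cons_cons] at ih ⊢
    rw [ih, axpyG_apply, if_pos hx]
    simp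

/-! ### One Horner step -/

/-- The argument record of the Horner step: from `z = ⟨x, ⟨B, ⟨a, ⟨a', acc⟩⟩⟩⟩` to
`⟨x, ⟨bin |x|, ⟨a, ⟨B, rotF acc⟩⟩⟩⟩` (the record `zipLF axpyG` runs on). [folklore] -/
noncomputable def mstepArg : List Bool → List Bool :=
  fanoutFn fstF (fanoutFn (lenBinF ∘ fstF) (fanoutFn (nthF 2) (fanoutFn (nthF 1) (rotF ∘ sndPow 3))))

/-- **The Horner step** `mstepG ⟨x, ⟨B, ⟨a, ⟨a', acc⟩⟩⟩⟩ = pcode (axpy n a B (rot acc))` (the second copy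
`a'` of the coefficient is ignored: the fold runs over the list of coefficients zipped with itself).
[cite: KnuthTAOCP2, §4.6.1] -/
noncomputable def mstepG : List Bool → List Bool := zipLF axpyG ∘ mstepArg

/-- `mstepArg` spelled out. [folklore] -/
theorem mstepArg_apply (x p a a' acc : List Bool) :
    mstepArg (boolPair x (boolPair p (boolPair a (boolPair a' acc)))) =
      boolPair x (boolPair (encodeNat x.length) (boolPair a (boolPair p (rotF acc)))) := by
  simp [mstepArg]

/-- `mstepG ∈ FP`. [folklore] -/
theorem mstepG_mem_FP : mstepG ∈ FP :=
  comp_mem_FP (zipLF_mem_FP axpyG_mem_FP (w := 0) (by norm_num) length_axpyG_le)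
    (fanoutFn_mem_FP fstF_mem_FP (fanoutFn_mem_FP (comp_mem_FP lenBinF_mem_FP fstF_mem_FP)
      (fanoutFn_mem_FP (nthF_mem_FP 2) (fanoutFn_mem_FP (nthF_mem_FP 1) (comp_mem_FP rotF_mem_FP (sndPow_mem_FP 3))))))

/-- The absolute output bound of the Horner step: `|x| (2|x| + 4)`. [folklore] -/
noncomputable def mstepBound : Polynomial ℕ := X * (2 * X + 4)

/-- **Growth of the Horner step**: absolutely bounded by `mstepBound (|x|)`, on every input. [folklore] -/
theorem length_mstepG_le' (z : List Bool) : (mstepG z).length ≤ mstepBound.eval (fstF z).length := by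
  have h := length_zipLF_le 0 length_axpyG_le (mstepArg z)
  have hx : fstF (mstepArg z) = fstF z := by simp [mstepArg]
  rw [hx] at h
  simpa [mstepG, mstepBound] using h

/-- Growth of the Horner step in the shape `zipFoldLF_mem_FP` asks for. [folklore] -/
theorem length_mstepG_le (x p a b acc : List Bool) :
    (mstepG (boolPair x (boolPair p (boolPair a (boolPair b acc))))).length ≤
      acc.length + 2 * (a.length + b.length) + mstepBound.eval x.length := by
  have := length_mstepG_le' (boolPair x (boolPair p (boolPair a (boolPair b acc))))
  rw [fstF_boolPair] at this
  omega

/-- **Value of the Horner step** on genuine arguments: lists `B`, `acc ≠ []` of at most `|x|` entries.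
[cite: KnuthTAOCP2, §4.6.1] -/
theorem mstepG_apply {x : List Bool} (hx : 2 ≤ bitsToNat (fstF x)) (a : ℕ) (a' : List Bool) {B acc : List ℕ}
    (hB : B.length ≤ x.length) (hacc : acc.length ≤ x.length) (hne : acc ≠ []) :
    mstepG (boolPair x (boolPair (pcode B) (boolPair (encodeNat a) (boolPair a' (pcode acc))))) =
      pcode (CycList.axpy (bitsToNat (fstF x)) a B (CycList.rot acc)) := by
  rw [mstepG, Function.comp_apply, mstepArg_apply, rotF_pcode hne, pcode, pcode, zipLF_apply _ _ _ le_rfl,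
    List.take_of_length_le (by simpa using hB), List.take_of_length_le (by simpa using hacc), zipImages_axpyG hx]
  rfl

/-! ### The product -/

/-- **`zeroOfG ⟨x, A⟩`**: the code of the zero list with as many entries as `A` (a map to `ε = encodeNat 0`).
[folklore] -/
noncomputable def zeroOfG : List Bool → List Bool :=
  mapLF (fun _ => []) ∘ fanoutFn fstF (fanoutFn (lenBinF ∘ fstF) (fanoutFn (fun _ => []) sndF))

/-- `zeroOfG ∈ FP`. [folklore] -/
theorem zeroOfG_mem_FP : zeroOfG ∈ FP :=
  comp_mem_FP (mapLF_mem_FP (const_mem_FP _) (w := 0) (by norm_num) (P := 0) (fun _ _ _ => by simp))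
    (fanoutFn_mem_FP fstF_mem_FP (fanoutFn_mem_FP (comp_mem_FP lenBinF_mem_FP fstF_mem_FP)
      (fanoutFn_mem_FP (const_mem_FP _) sndF_mem_FP)))

/-- Value of `zeroOfG` on a coded list of at most `|x|` entries. [folklore] -/
theorem zeroOfG_apply (x : List Bool) {A : List ℕ} (hA : A.length ≤ x.length) :
    zeroOfG (boolPair x (pcode A)) = pcode (CycList.zero A.length) := by
  simp only [zeroOfG, Function.comp_apply, fanoutFn_apply, fstF_boolPair, sndF_boolPair, lenBinF_apply, pcode]
  rw [mapLF_apply _ _ _ le_rfl, List.take_of_length_le (by simpa using hA), CycList.zero]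
  have h0 : encodeNat 0 = [] := rfl
  simp [Function.comp_def, List.map_const', h0]

/-- `zeroOfG` is absolutely bounded by `4 |x|`. [folklore] -/
theorem length_zeroOfG_le (z : List Bool) : (zeroOfG z).length ≤ 4 * (fstF z).length := by
  have h := length_mapLF_le 0 (f := fun _ => ([] : List Bool)) (P := 0) (fun _ _ _ => by simp)
    (fanoutFn fstF (fanoutFn (lenBinF ∘ fstF) (fanoutFn (fun _ => []) sndF)) z)
  simp only [fanoutFn_apply, fstF_boolPair, eval_zero, mul_zero, zero_add, zero_mul, Function.comp_apply] at h
  simpa [zeroOfG, mul_comm] using h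

/-- The argument record of the product: from `⟨x, ⟨A, B⟩⟩` to `⟨x, ⟨bin |x|, ⟨B, ⟨A, ⟨A, zeroOfG ⟨x, A⟩⟩⟩⟩⟩⟩`.
[folklore] -/
noncomputable def mulArg : List Bool → List Bool :=
  fanoutFn fstF (fanoutFn (lenBinF ∘ fstF) (fanoutFn (sndPow 1) (fanoutFn (nthF 1) (fanoutFn (nthF 1)
    (zeroOfG ∘ fanoutFn fstF (nthF 1))))))

/-- `mulArg` spelled out. [folklore] -/
theorem mulArg_apply (x A B : List Bool) :
    mulArg (boolPair x (boolPair A B)) =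
      boolPair x (boolPair (encodeNat x.length) (boolPair B (boolPair A (boolPair A (zeroOfG (boolPair x A)))))) := by
  simp [mulArg]

/-- `mulArg ∈ FP`. [folklore] -/
theorem mulArg_mem_FP : mulArg ∈ FP :=
  fanoutFn_mem_FP fstF_mem_FP (fanoutFn_mem_FP (comp_mem_FP lenBinF_mem_FP fstF_mem_FP)
    (fanoutFn_mem_FP (sndPow_mem_FP 1) (fanoutFn_mem_FP (nthF_mem_FP 1) (fanoutFn_mem_FP (nthF_mem_FP 1)
      (comp_mem_FP zeroOfG_mem_FP (fanoutFn_mem_FP fstF_mem_FP (nthF_mem_FP 1)))))))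

/-- **The product brick** `mulG ⟨x, ⟨A, B⟩⟩`: the Horner fold of `mstepG` over the coefficients of `A`.
[cite: AgrawalKayalSaxena2004, §5] -/
noncomputable def mulG : List Bool → List Bool := zipFoldLF mstepG ∘ mulArg

/-- **`mulG ∈ FP`.** [cite: AroraBarak2009, §1.3 (bounded loops)] -/
theorem mulG_mem_FP : mulG ∈ FP :=
  comp_mem_FP (zipFoldLF_mem_FP mstepG_mem_FP length_mstepG_le) mulArg_mem_FP

/-- The Horner fold on codes follows the list-level fold. [folklore] -/
theorem zipFoldValue_mstepG {x : List Bool} (hx : 2 ≤ bitsToNat (fstF x)) {B : List ℕ} (hB : B.length ≤ x.length)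
    (hB0 : B ≠ []) : ∀ (A acc : List ℕ), acc.length = B.length →
    zipFoldValue mstepG x (pcode B) (A.map encodeNat) (A.map encodeNat) (pcode acc) =
      pcode (A.foldl (fun acc a => CycList.axpy (bitsToNat (fstF x)) a B (CycList.rot acc)) acc)
  | [], acc, _ => by simp [zipFoldValue]
  | a :: A, acc, hacc => by
    have hne : acc ≠ [] := by rintro rfl; simp at hacc; exact hB0 (List.eq_nil_of_length_eq_zero hacc.symm)
    have h1 := mstepG_apply hx a (encodeNat a) hB (hacc ▸ hB) hne
    have ih := zipFoldValue_mstepG hx hB hB0 A (CycList.axpy (bitsToNat (fstF x)) a B (CycList.rot acc)) (by simp [hacc])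
    simp only [zipFoldValue, List.map_cons, List.zip_cons_cons, List.foldl_cons] at ih ⊢
    rw [h1, ih]

/-- **Value of the product brick**: for `n = ⟦fstF x⟧ ≥ 2` and coefficient lists `A`, `B` of the same
length `≤ |x|`, `mulG ⟨x, ⟨pcode A, pcode B⟩⟩ = pcode (CycList.mul n A B)`. [cite: AgrawalKayalSaxena2004, §5] -/
theorem mulG_apply {x : List Bool} (hx : 2 ≤ bitsToNat (fstF x)) {A B : List ℕ} (hAB : A.length = B.length)
    (hB : B.length ≤ x.length) :
    mulG (boolPair x (boolPair (pcode A) (pcode B))) = pcode (CycList.mul (bitsToNat (fstF x)) A B) := by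
  rw [mulG, Function.comp_apply, mulArg_apply, zeroOfG_apply x (hAB ▸ hB)]
  have key := zipFoldLF_apply mstepG x (pcode B) (k := x.length) le_rfl (A.map encodeNat) (A.map encodeNat)
    (pcode (CycList.zero A.length))
  rw [List.take_of_length_le (by simp; omega)] at key
  rw [show pcode A = encList (A.map encodeNat) from rfl, key]
  rcases eq_or_ne B [] with rfl | hB0
  · have hA : A = [] := List.eq_nil_of_length_eq_zero (by simpa using hAB)
    subst hA
    simp [zipFoldValue, CycList.mul, CycList.zero, pcode]
  · rw [zipFoldValue_mstepG hx hB hB0 A _ (by simp [hAB]), CycList.mul, CycList.zero]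

/-- The absolute output bound of the product brick. [folklore] -/
noncomputable def mulBound : Polynomial ℕ := 4 * X + mstepBound

/-- **The product brick is absolutely bounded**: `|mulG z| ≤ mulBound (|fstF z|)` on EVERY input — the
result is the initial zero list or an output of the Horner step (a potential argument over the run of the
fold loop). [folklore] -/
theorem length_mulG_le (z : List Bool) : (mulG z).length ≤ mulBound.eval (fstF z).length := by
  set x := fstF z with hxdef
  set G := mstepBound.eval x.length with hG
  have hrec : mulArg z = boolPair x (boolPair (encodeNat x.length) (boolPair (sndPow 1 z) (boolPair (nthF 1 z)
      (boolPair (nthF 1 z) (zeroOfG (boolPair x (nthF 1 z))))))) := by simp [mulArg, hxdef]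
  have hpot := potential_loopRun_le (body := zipFoldBody mstepG) (x := x)
    (fun S => max (sndPow 2 S).length G) 0 (fun c s _ => ?_) x.length (encodeNat x.length)
    (boolPair (sndPow 1 z) (boolPair (nthF 1 z) (boolPair (nthF 1 z) (zeroOfG (boolPair x (nthF 1 z))))))
  · rw [mulG, Function.comp_apply, zipFoldLF_eq, hrec]
    simp only [fstF_boolPair, nthF_succ_boolPair, nthF_zero_boolPair, sndPow_succ_boolPair, sndPow_zero, sndF_boolPair,
      mul_zero, add_zero] at hpot ⊢
    have hz := length_zeroOfG_le (boolPair x (nthF 1 z))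
    rw [fstF_boolPair] at hz
    refine (le_max_left _ _).trans (hpot.trans ?_)
    simp only [mulBound, eval_add, eval_mul, eval_ofNat, eval_X, ← hG]
    omega
  · rw [zipFoldBody_state]
    split_ifs
    · exact Nat.le_refl _
    · exact Nat.le_refl _
    · simp only [sndPow_succ_boolPair, sndPow_zero, sndF_boolPair, add_zero]
      have := length_mstepG_le' (boolPair x (boolPair (fstF s) (boolPair (fstF (nthF 1 s)) (boolPair (fstF (nthF 2 s)) (sndPow 2 s)))))
      rw [fstF_boolPair, ← hG] at this
      exact max_le (this.trans (le_max_right _ _)) (le_max_right _ _)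

end Brick

end Literature.Computability.Complexity
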